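import Summits.ABC.ABC.Theorems.DefiniteXiDefiniteRTControlPrimeOfTakahashi
import Literature.NumberTheory.EllipticCurves.TakahashiDegreeFormulaCoprimeProofs
import HarnessLib

/-!
# Line `TakahashiLeaves` — crux `DefiniteXi.DefiniteRTControlPrime` (stmt-ABC-11338): 2-stub skeleton CANDIDATE

Status: CANDIDATE, NOT REGISTERED (written by stub-ideation k2 g13 for `stub_pastenLemma68`, which has no
registration rights).  Purpose: a lint-safe skeleton with **≥ 2 genuine, load-bearing stubs** that expires BOTH
Pasten stubs of `Lines/Sketch.lean` (`stub_pastenLemma68 : PastenShimura2024_lemma_6_8` and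
`stub_pasten163 : PastenShimura2024_minimalDegree_le_163_mul`, each Mazur–Kenku-complete as typed and not
needed by the crux) WITHOUT keeping a blocked stub (contrast `Lines/TwoFacts.lean`, which keeps `stub_pasten163`).

The two stubs are the standard two-leaf split of Takahashi 2001 Thm 2.3 (coprime form) typed by ideator k1
(`Cruxes/DefiniteRTControlPrime/StubIdeas1G15TakahashiSketch.lean`, `…1G18…`, bodies VERBATIM):
* `stub_brandtRankOne`  = `H_R`, multiplicity one of the Brandt eigen-lattice at coprime level `(M, r)`
  (Eichler / Pizer 1980 Thm 2.28 / Jacquet–Langlands);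
* `stub_characterGroupDictionary` = `H_D`, the character-group dictionary at `r ∥ N`
  (Ribet 1990, Conrad–Stein 2001 Thm 6.1 + §7.1, Takahashi 2001 §2).
Composition: leaves ⟹ `takahashi2001_thm_2_3_of_coprime` (tree:
`takahashi2001_thm_2_3_of_coprime_of_brandtDictionary_one'`) ⟹ crux (LANDED k2-g12 chain, part 7/7:
`Summit.ABC.ABC.Theorems.DefiniteRTControlPrime.definiteRTControlPrime_of_takahashi` — isogeny radius of the Frey
class `≤ R_ε N^ε` unconditionally, no Lemma 6.8, no `163`).

A seat with rights registers it with
  ledger skeleton check "$(ledger crux dir stmt-ABC-11338)/Lines/TakahashiLeaves.lean" --crux stmt-ABC-11338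
(prefer the 1-stub `Lines/Takahashi.lean` if a single named-fact stub is acceptable to the lint; prefer the tenure
re-glue of `closes` over both — see `STUB-IDEAS-stub_pastenLemma68-2.md` §3).
-/

set_option linter.dupNamespace false

namespace Summit.ABC.ABC.Cruxes.DefiniteRTControlPrime.TakahashiLeaves

open scoped BigOperators
open Literature.NumberTheory.EllipticCurves
open Literature.NumberTheory.EllipticCurves.ModularForms
open Literature.NumberTheory.Automorphic
open Summit.ABC.ABC.Theses.DefiniteXi

/-- stub 1 (`H_R`, k1-g15/g18 verbatim): multiplicity one for the Brandt eigen-lattice of `W` at coprime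
level `(M, r)`, `r` prime, `N(W) = M r`. [cite: Pizer1980, Def. 1.2, Thm. 2.28] [cite: Takahashi2001, §2 p. 78] -/
theorem stub_brandtRankOne :
    ∀ (W : WeierstrassCurve ℚ) [W.IsElliptic] (M r : ℕ) [NeZero (M * r)],
      r.Prime → M.Coprime r → W.conductorNorm ℤ = M * r →
      ∀ (_P : ModularParametrizationData W (M * r)) (S : Brandt.XiSetup M r)
        [Fintype (Brandt.ClassSet S.O)],
        Module.finrank ℤ
          (Brandt.eigenLattice (M * r) (Brandt.matrix S.O) (fun n => W.LFunction n)) = 1 := by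
  sorry

/-- stub 2 (`H_D`, k1-g15/g18 verbatim): the character-group dictionary at `r ∥ N` in the stub's idiom
(`c_r := ord_r Δ_min(W)`): the saturated lattice `X`, `pb : ℤ → X` with `pf ∘ pb = deg P`, the monodromy
pairing value `ord_r(Δ_min) · a · pf y`, and `pb 1` in the eigen-lattice.
[cite: ConradStein2001, Thm. 6.1, §7.1] [cite: Takahashi2001, Prop. 1.1, Thm. 2.3 (p. 79)] -/
theorem stub_characterGroupDictionary :
    ∀ (W : WeierstrassCurve ℚ) [W.IsElliptic] (M r : ℕ) [NeZero (M * r)],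
      r.Prime → M.Coprime r → W.conductorNorm ℤ = M * r →
      ∀ P : ModularParametrizationData W (M * r),
        (∀ (W' : WeierstrassCurve ℚ) [W'.IsElliptic], W'.conductorNorm ℤ = M * r →
            ∀ P' : ModularParametrizationData W' (M * r),
            P'.f = P.f → P.modularDegree ≤ P'.modularDegree) →
        ∀ (S : Brandt.XiSetup M r) [Fintype (Brandt.ClassSet S.O)],
          ∃ (X : Submodule ℤ (Brandt.ClassSet S.O → ℤ)) (pb : ℤ →ₗ[ℤ] X) (pf : X →ₗ[ℤ] ℤ),
            (∀ (a : ℤ) (y : X),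
                ∑ i, (Brandt.weight S.O i : ℤ) * (pb a : Brandt.ClassSet S.O → ℤ) i *
                    (y : Brandt.ClassSet S.O → ℤ) i =
                  ((W.minimalDiscriminantNorm ℤ).factorization r : ℤ) * a * pf y) ∧
            (∀ a : ℤ, pf (pb a) = (P.modularDegree : ℤ) * a) ∧
            Function.Surjective pf ∧
            (∀ (m : ℤ) (v : Brandt.ClassSet S.O → ℤ), m ≠ 0 → m • v ∈ X → v ∈ X) ∧
            (pb 1 : Brandt.ClassSet S.O → ℤ) ∈
              Brandt.eigenLattice (M * r) (Brandt.matrix S.O) (fun n => W.LFunction n) := by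
  sorry

/-- Leaves ⟹ Takahashi 2001 Thm 2.3 (coprime form), by the tree bridge
`takahashi2001_thm_2_3_of_coprime_of_brandtDictionary_one'` (k1-g15 `takahashi2001_thm_2_3_of_coprime_holds_of`,
re-proved here so that the line file imports tree modules only). -/
theorem takahashi_of_leaves
    (h₁ : ∀ (W : WeierstrassCurve ℚ) [W.IsElliptic] (M r : ℕ) [NeZero (M * r)],
      r.Prime → M.Coprime r → W.conductorNorm ℤ = M * r →
      ∀ (_P : ModularParametrizationData W (M * r)) (S : Brandt.XiSetup M r)
        [Fintype (Brandt.ClassSet S.O)],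
        Module.finrank ℤ
          (Brandt.eigenLattice (M * r) (Brandt.matrix S.O) (fun n => W.LFunction n)) = 1)
    (h₂ : ∀ (W : WeierstrassCurve ℚ) [W.IsElliptic] (M r : ℕ) [NeZero (M * r)],
      r.Prime → M.Coprime r → W.conductorNorm ℤ = M * r →
      ∀ P : ModularParametrizationData W (M * r),
        (∀ (W' : WeierstrassCurve ℚ) [W'.IsElliptic], W'.conductorNorm ℤ = M * r →
            ∀ P' : ModularParametrizationData W' (M * r),
            P'.f = P.f → P.modularDegree ≤ P'.modularDegree) →
        ∀ (S : Brandt.XiSetup M r) [Fintype (Brandt.ClassSet S.O)],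
          ∃ (X : Submodule ℤ (Brandt.ClassSet S.O → ℤ)) (pb : ℤ →ₗ[ℤ] X) (pf : X →ₗ[ℤ] ℤ),
            (∀ (a : ℤ) (y : X),
                ∑ i, (Brandt.weight S.O i : ℤ) * (pb a : Brandt.ClassSet S.O → ℤ) i *
                    (y : Brandt.ClassSet S.O → ℤ) i =
                  ((W.minimalDiscriminantNorm ℤ).factorization r : ℤ) * a * pf y) ∧
            (∀ a : ℤ, pf (pb a) = (P.modularDegree : ℤ) * a) ∧
            Function.Surjective pf ∧
            (∀ (m : ℤ) (v : Brandt.ClassSet S.O → ℤ), m ≠ 0 → m • v ∈ X → v ∈ X) ∧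
            (pb 1 : Brandt.ClassSet S.O → ℤ) ∈
              Brandt.eigenLattice (M * r) (Brandt.matrix S.O) (fun n => W.LFunction n)) :
    takahashi2001_thm_2_3_of_coprime := by
  refine takahashi2001_thm_2_3_of_coprime_of_brandtDictionary_one' ?_
  intro W _ M r _ hr hcop hN P hmin hne
  obtain ⟨S₀⟩ := hne
  classical
  letI : Fintype (Brandt.ClassSet S₀.O) := Fintype.ofFinite _
  obtain ⟨X, pb, pf, hadj, hδ, hsurj, hXsat, hmem⟩ := h₂ W M r hr hcop hN P hmin S₀
  exact ⟨S₀, inferInstance, X, pb, pf, hadj, hδ, hsurj, hXsat, h₁ W M r hr hcop hN P S₀, hmem⟩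

/-- The crux BY NAME from the two stubs (kernel-checked: leaves ⟹ Takahashi ⟹ crux via the landed
`definiteRTControlPrime_of_takahashi`). -/
theorem DefiniteRTControlPrime_of : Summit.ABC.ABC.Theses.DefiniteXi.DefiniteRTControlPrime :=
  Summit.ABC.ABC.Theorems.DefiniteRTControlPrime.definiteRTControlPrime_of_takahashi
    (takahashi_of_leaves stub_brandtRankOne stub_characterGroupDictionary)

end Summit.ABC.ABC.Cruxes.DefiniteRTControlPrime.TakahashiLeaves
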